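import Summits.ValiantsHypothesis.ValiantsHypothesis.Theorems.LacunarySymmetroidMatrixDescartesPivotArrowSixKit
import Summits.ValiantsHypothesis.ValiantsHypothesis.Theorems.LacunarySymmetroidMatrixDescartesPivotArrowFourLetters

/-!
# `MatrixDescartes` (stmt-ValiantsHypothesis-18050) — THE `K = 4` PIVOT COLUMN AT ALL SIZES:
# `¬ PivotRootLawAt m 4 1 (6m − 5)` for EVERY `m`; the bilinear rank-one pivot law is SHARP along `K = 4` if true

HONEST FRAMING.  Cell `pub-symmetroid`, seat `val-sym-mdr-p2` (gen 8); helper file `--supports` the crux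
`Theses.LacunarySymmetroid.MatrixDescartes` (OPEN), NO closure claim.  A LOWER-bound / sharpness row for conjb-1's typed
pivot currency (`…CensusPivotDefs`: `Pivot.PivotRootLawAt m K q B` — every `m × m` pivot pencil `X^e J + ∑ₖ X^{dₖ} Pₖ` with
`K` PSD letters and `J` of negative index `≤ q` has `Z₊ ≤ B`).  Nothing here bears on `MatrixDescartes` in its window, on
`stub_twoSided`, `DoorA26` / `DoorA34`, the census registers, or `VP ≠ VNP`.

RESULT.  **`not_pivotRootLawAt_four_one : 1 ≤ m → ¬ PivotRootLawAt m 4 1 (6m − 5)`** — at format `(m, K) = (m, 4)` and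
pivot index ONE, `Z₊ ≥ 6m − 4` for every `m` (the tree had `8` at `m = 2`, `…PivotTwoFourWitness`, and `4m` at even `m`
with index `m/2`, `Pivot.not_pivotRootLawAt_four_of_even`).  `6m − 4 = 2(m−1)(K−1) + 2` is EXACTLY the budget of the typed
bilinear guess `Pivot.RankOnePivotLawBilinear` (conjb-1 g2, NOT asserted) at `K = 4`: **if the guess holds it is sharp
along the whole `K = 4` column** (`pivotRootLawAt_four_one_iff_of_bilinear`), as along `K = 2` (V-law) and `K = 3`
(`…WLawArrowPivot`).

CONSTRUCTION (`exists_pivotConfig_indexOne`): the BALANCED arrowhead letters of `…PivotArrowFourLetters` (support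
`(3; 0, 2; 5, 19)`; sub-pivot borders `+ω`, super-pivot borders `−ω`, diagonal `J` with one negative corner entry) at
separated scales `Ξ₁ ≪ Ξ₂ ≪ ⋯`; by `det_pencil_eval` the determinant at `x > 0` is a positive multiple of
`x⁻³ − 1 + ∑ᵢ Uᵢ φ₄(x/Ξᵢ) + s x¹⁶`, and the reference shape `φ₄` (`→ 0` at both ends) crosses the level `73/20` SIX times
(`phi_p1` … `phi_p6` below: an in-block «staircase», the top exponent `19` makes the top letter activate at the pole of
the lower factor); the generic soft induction `PivotArrowSix.model_alternates` gives `6k + 2` alternations with `k`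
blocks, the slack `s x¹⁶` one more on the far right (`end_step`), the intermediate value theorem
(`WLawArrow.le_card_posRoots_of_alternating_anti`) `6k + 2 = 6(k+1) − 4` distinct positive roots in size `k + 1`.
So per unit of size a balanced block contributes `6 = 2(K−1)` roots at `K = 4` (four at `K = 3`): the mechanism
«`2(K−1)` per block `+ 2` ends» reproduces the bilinear form `2(m−1)(K−1) + 2`; only `K ≤ 4` is in the kernel.

[folklore] Elementary; tree inputs `…PivotArrowSixKit`, `…PivotArrowFourLetters`, `WLawArrow.prod_neg_of_alt`,
`WLawArrow.le_card_posRoots_of_alternating_anti`, `…CensusPivotDefs`.  Axioms `propext`, `Classical.choice`, `Quot.sound`.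
-/

set_option linter.dupNamespace false

namespace Summit.ValiantsHypothesis.ValiantsHypothesis.Theorems.LacunarySymmetroidMatrixDescartes

open scoped BigOperators Topology Matrix
open Filter Matrix Polynomial

namespace PivotArrowFour

/-- The reference block shape `φ₄` (local notation, no definition). -/
local notation3 (prettyPrint := false) "φ₄[" y "]" =>
  ((y : ℝ) ^ 2 * (4 * (2 / 25 + 27 / 20 * (y : ℝ) ^ 2) * (17000 + 1200 * (y : ℝ) ^ 14) - 40000 * (y : ℝ))
    / (2 / 25 + 27 / 20 * (y : ℝ) ^ 2 + 200 * (y : ℝ) ^ 3 + 17000 * (y : ℝ) ^ 5 + 1200 * (y : ℝ) ^ 19))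

/-- The scalar model `M₄(x) = x⁻³ − 1 + ∑ᵢ Uᵢ φ₄(x / Ξᵢ)` (local notation, no definition). -/
local notation3 (prettyPrint := false) "M₄[" Ξ ", " U "](" x ")" =>
  ((x : ℝ)⁻¹ ^ 3 - 1 + ∑ i, (U : Fin _ → ℝ) i * φ₄[(x : ℝ) / (Ξ : Fin _ → ℝ) i])

/-- Letter `P_a` (exponent `0`; local notation, no definition). -/
local notation3 (prettyPrint := false) "Pa[" Ξ ", " U "]" =>
  Matrix.fromBlocks (diagonal fun i => 2 / 25 * (Ξ : Fin _ → ℝ) i ^ 35 / (U : Fin _ → ℝ) i)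
    (Matrix.of fun (i : Fin _) (_ : Fin 1) => 2 / 25 * (Ξ : Fin _ → ℝ) i ^ 19)
    (Matrix.of fun (_ : Fin 1) (i : Fin _) => 2 / 25 * (Ξ : Fin _ → ℝ) i ^ 19)
    (Matrix.of fun (_ _ : Fin 1) => (∑ i, 2 / 25 * (U : Fin _ → ℝ) i * (Ξ : Fin _ → ℝ) i ^ 3) + 1)

/-- Letter `P_b` (exponent `2`; local notation, no definition). -/
local notation3 (prettyPrint := false) "Pb[" Ξ ", " U "]" =>
  Matrix.fromBlocks (diagonal fun i => 27 / 20 * (Ξ : Fin _ → ℝ) i ^ 33 / (U : Fin _ → ℝ) i)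
    (Matrix.of fun (i : Fin _) (_ : Fin 1) => 27 / 20 * (Ξ : Fin _ → ℝ) i ^ 17)
    (Matrix.of fun (_ : Fin 1) (i : Fin _) => 27 / 20 * (Ξ : Fin _ → ℝ) i ^ 17)
    (Matrix.of fun (_ _ : Fin 1) => ∑ i, 27 / 20 * (U : Fin _ → ℝ) i * (Ξ : Fin _ → ℝ) i)

/-- The pivot letter `J` (exponent `3`; diagonal; local notation, no definition). -/
local notation3 (prettyPrint := false) "J4[" Ξ ", " U "]" =>
  Matrix.fromBlocks (diagonal fun i => 200 * (Ξ : Fin _ → ℝ) i ^ 32 / (U : Fin _ → ℝ) i) 0 0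
    (Matrix.of fun (_ _ : Fin 1) => -1 - 200 * ∑ i, (U : Fin _ → ℝ) i)

/-- Letter `Q_c` (exponent `5`; local notation, no definition). -/
local notation3 (prettyPrint := false) "Qc[" Ξ ", " U "]" =>
  Matrix.fromBlocks (diagonal fun i => 17000 * (Ξ : Fin _ → ℝ) i ^ 30 / (U : Fin _ → ℝ) i)
    (Matrix.of fun (i : Fin _) (_ : Fin 1) => -(17000 * (Ξ : Fin _ → ℝ) i ^ 14))
    (Matrix.of fun (_ : Fin 1) (i : Fin _) => -(17000 * (Ξ : Fin _ → ℝ) i ^ 14))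
    (Matrix.of fun (_ _ : Fin 1) => ∑ i, 17000 * (U : Fin _ → ℝ) i / (Ξ : Fin _ → ℝ) i ^ 2)

/-- Letter `Q_d` (exponent `19`; carries the slack `s`; local notation, no definition). -/
local notation3 (prettyPrint := false) "Qd[" Ξ ", " U ", " s "]" =>
  Matrix.fromBlocks (diagonal fun i => 1200 * (Ξ : Fin _ → ℝ) i ^ 16 / (U : Fin _ → ℝ) i)
    (Matrix.of fun (_ : Fin _) (_ : Fin 1) => -(1200 : ℝ))
    (Matrix.of fun (_ : Fin 1) (_ : Fin _) => -(1200 : ℝ))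
    (Matrix.of fun (_ _ : Fin 1) => (∑ i, 1200 * (U : Fin _ → ℝ) i / (Ξ : Fin _ → ℝ) i ^ 16) + (s : ℝ))

/-- Reindexing `Fin k ⊕ Fin 1 ≃ Fin (k + 1)` (local notation). -/
local notation3 (prettyPrint := false) "rx[" A "]" => Matrix.reindex finSumFinEquiv finSumFinEquiv A

/-- The four PSD letters as a `Fin 4`-family (local notation). -/
local notation3 (prettyPrint := false) "P4[" Ξ ", " U ", " s "]" =>
  (![rx[Pa[Ξ, U]], rx[Pb[Ξ, U]], rx[Qc[Ξ, U]], rx[Qd[Ξ, U, s]]] : Fin 4 → Matrix (Fin (_ + 1)) (Fin (_ + 1)) ℝ)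

/-! ## The reference block shape -/

/-- The denominator of `φ₄` is positive on `[0, ∞)`. [folklore] -/
theorem den_pos {y : ℝ} (hy : 0 ≤ y) :
    0 < 2 / 25 + 27 / 20 * y ^ 2 + 200 * y ^ 3 + 17000 * y ^ 5 + 1200 * y ^ 19 := by positivity

/-- `φ₄(1/20) > 73/20` (first excursion). [folklore] -/
theorem phi_p1 : (73 / 20 : ℝ) < φ₄[(1 / 20 : ℝ)] := by norm_num

/-- `φ₄(3/10) < 73/20` (first dip). [folklore] -/
theorem phi_p2 : φ₄[(3 / 10 : ℝ)] < 73 / 20 := by norm_num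

/-- `φ₄(3/5) > 73/20` (second excursion). [folklore] -/
theorem phi_p3 : (73 / 20 : ℝ) < φ₄[(3 / 5 : ℝ)] := by norm_num

/-- `φ₄(1) < 73/20` (second dip). [folklore] -/
theorem phi_p4 : φ₄[(1 : ℝ)] < 73 / 20 := by norm_num

/-- `φ₄(13/10) > 73/20` (third excursion). [folklore] -/
theorem phi_p5 : (73 / 20 : ℝ) < φ₄[(13 / 10 : ℝ)] := by norm_num

/-- `φ₄(10) < 73/20` (the tail). [folklore] -/
theorem phi_p6 : φ₄[(10 : ℝ)] < 73 / 20 := by norm_num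

/-- `φ₄(y) → 0` as `y → 0`. [folklore] -/
theorem tendsto_phi_zero : Tendsto (fun y : ℝ => φ₄[y]) (𝓝 0) (𝓝 0) := by
  have h : ContinuousAt (fun y : ℝ => φ₄[y]) 0 := by
    refine ContinuousAt.div ?_ ?_ ?_
    · fun_prop
    · fun_prop
    · norm_num
  simpa using h.tendsto

/-- `φ₄(y) → 0` as `y → ∞` (numerator degree `18`, denominator degree `19`). [folklore] -/
theorem tendsto_phi_atTop : Tendsto (fun y : ℝ => φ₄[y]) atTop (𝓝 0) := by
  have hg : Tendsto (fun u : ℝ => (4 * u * (2 / 25 * u ^ 2 + 27 / 20) * (17000 * u ^ 14 + 1200) - 40000 * u ^ 16)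
      / (2 / 25 * u ^ 19 + 27 / 20 * u ^ 17 + 200 * u ^ 16 + 17000 * u ^ 14 + 1200)) (𝓝 0) (𝓝 0) := by
    have hc : ContinuousAt (fun u : ℝ => (4 * u * (2 / 25 * u ^ 2 + 27 / 20) * (17000 * u ^ 14 + 1200)
        - 40000 * u ^ 16) / (2 / 25 * u ^ 19 + 27 / 20 * u ^ 17 + 200 * u ^ 16 + 17000 * u ^ 14 + 1200)) 0 := by
      refine ContinuousAt.div ?_ ?_ ?_
      · fun_prop
      · fun_prop
      · norm_num
    simpa using hc.tendsto
  refine (hg.comp tendsto_inv_atTop_zero).congr' ?_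
  filter_upwards [eventually_gt_atTop (0 : ℝ)] with y hy
  have hy' : y ≠ 0 := hy.ne'
  have hd : (2 / 25 + 27 / 20 * y ^ 2 + 200 * y ^ 3 + 17000 * y ^ 5 + 1200 * y ^ 19) ≠ 0 := (den_pos hy.le).ne'
  simp only [Function.comp_apply]
  rw [div_eq_div_iff ?_ hd]
  · field_simp
  · have : 0 < 2 / 25 * y⁻¹ ^ 19 + 27 / 20 * y⁻¹ ^ 17 + 200 * y⁻¹ ^ 16 + 17000 * y⁻¹ ^ 14 + 1200 := by
      positivity
    exact this.ne'


/-! ## The end step: a small slack adds one sign change on the far right -/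

/-- **The slack.**  Given the alternating data of the scalar model, some `s > 0` keeps all the signs of `M₄ + s x¹⁶` at the
listed points and some point `X` beyond the list has `M₄(X) + s X¹⁶ > 0`. [folklore] -/
theorem end_step {k m : ℕ} (Ξ U : Fin k → ℝ) (hΞ : ∀ i, 0 < Ξ i)
    (σ : Fin (m + 1) → ℝ) (hsign : ∀ j : Fin (m + 1), 0 < (-1 : ℝ) ^ ((j : ℕ) + 1) * M₄[Ξ, U](σ j)) :
    ∃ s X : ℝ, 0 < s ∧ σ 0 < X ∧ 0 < M₄[Ξ, U](X) + s * X ^ 16 ∧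
      ∀ j : Fin (m + 1), 0 < (-1 : ℝ) ^ ((j : ℕ) + 1) * (M₄[Ξ, U](σ j) + s * σ j ^ 16) := by
  have E : ∀ j : Fin (m + 1), ∀ᶠ s : ℝ in 𝓝[>] 0,
      0 < (-1 : ℝ) ^ ((j : ℕ) + 1) * (M₄[Ξ, U](σ j) + s * σ j ^ 16) := by
    intro j
    have ht : Tendsto (fun s : ℝ => (-1 : ℝ) ^ ((j : ℕ) + 1) * (M₄[Ξ, U](σ j) + s * σ j ^ 16)) (𝓝[>] 0)
        (𝓝 ((-1 : ℝ) ^ ((j : ℕ) + 1) * (M₄[Ξ, U](σ j) + 0 * σ j ^ 16))) :=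
      tendsto_nhdsWithin_of_tendsto_nhds (((tendsto_id.mul_const _).const_add _).const_mul _)
    rw [zero_mul, add_zero] at ht
    exact ht.eventually_const_lt (hsign j)
  obtain ⟨s, hs, hsigns⟩ :=
    ((eventually_mem_nhdsWithin (a := (0 : ℝ)) (s := Set.Ioi 0)).and (eventually_all.2 E)).exists
  rw [Set.mem_Ioi] at hs
  have hM : Tendsto (fun x : ℝ => M₄[Ξ, U](x)) atTop (𝓝 (-1)) := by
    simpa only using PivotArrowSix.model_tendsto_atTop (fun y => φ₄[y]) tendsto_phi_atTop Ξ U hΞ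
  have hT : Tendsto (fun x : ℝ => M₄[Ξ, U](x) + s * x ^ 16) atTop atTop :=
    hM.add_atTop ((tendsto_pow_atTop (by norm_num : (16 : ℕ) ≠ 0)).const_mul_atTop hs)
  obtain ⟨X, hX1, hX2⟩ := ((hT.eventually_gt_atTop 0).and (eventually_gt_atTop (σ 0))).exists
  exact ⟨s, X, hs, hX2, hX1, hsigns⟩

/-! ## The theorems -/

/-- **BALANCED ARROWHEAD PIVOT PENCILS WITH `6k + 2` POSITIVE ROOTS IN EVERY SIZE `k + 1`, INDEX ONE.**  For every `k`:
an explicit `(k+1) × (k+1)` pivot pencil with four PSD letters on the exponents `(0, 2, 5, 19)`, pivot exponent `3`,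
`J` symmetric with `J + W Wᵀ ⪰ 0` for ONE column `W`, and at least `6k + 2` distinct positive determinant roots.
[folklore] -/
theorem exists_pivotConfig_indexOne (k : ℕ) :
    ∃ (J : Matrix (Fin (k + 1)) (Fin (k + 1)) ℝ) (P : Fin 4 → Matrix (Fin (k + 1)) (Fin (k + 1)) ℝ)
      (W : Matrix (Fin (k + 1)) (Fin 1) ℝ),
      J.IsSymm ∧ (∀ l, (P l).PosSemidef) ∧ (J + W * Wᵀ).PosSemidef ∧
      6 * k + 2 ≤ Pivot.pivotPosRoots 3 (![0, 2, 5, 19] : Fin 4 → ℕ) J P := by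
  obtain ⟨Ξ, U, σ, hΞ, hU, hanti, hpos, hsign⟩ :=
    PivotArrowSix.model_alternates (fun y => φ₄[y]) tendsto_phi_zero tendsto_phi_atTop
      (θ := 73 / 20) (p₁ := 10) (p₂ := 13 / 10) (p₃ := 1) (p₄ := 3 / 5) (p₅ := 3 / 10) (p₆ := 1 / 20)
      (by norm_num) (by norm_num) (by norm_num) (by norm_num) (by norm_num) (by norm_num) (by norm_num)
      phi_p6 phi_p5 phi_p4 phi_p3 phi_p2 phi_p1 k
  have hsign' : ∀ j : Fin (6 * k + 1 + 1), 0 < (-1 : ℝ) ^ ((j : ℕ) + 1) * M₄[Ξ, U](σ j) := fun j => by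
    simpa only using hsign j
  obtain ⟨s, Xr, hs, hX, hXval, hsigns⟩ := end_step Ξ U hΞ σ hsign'
  obtain ⟨W, hW⟩ := indexOne_J Ξ U hU
  refine ⟨rx[J4[Ξ, U]], P4[Ξ, U, s], W, isSymm_J Ξ U, posSemidef_letters Ξ U hΞ hU hs.le, hW, ?_⟩
  have hρpos : ∀ j, 0 < (vecCons Xr σ) j := by
    intro j
    refine Fin.cases ?_ (fun i => ?_) j
    · simpa using (hpos 0).trans hX
    · simpa using hpos i
  unfold Pivot.pivotPosRoots
  refine WLawArrow.le_card_posRoots_of_alternating_anti _ (6 * k + 1 + 1) (vecCons Xr σ) (hanti.vecCons hX) hρpos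
    fun j => ?_
  refine Fin.cases ?_ (fun i => ?_) j
  · have h0 := hsigns 0
    simp only [Fin.val_zero, zero_add, pow_one] at h0
    rw [Fin.castSucc_zero, Matrix.cons_val_zero, Fin.succ_zero_eq_one, Matrix.cons_val_one]
    exact eval_mul_eval_neg Ξ U hΞ hU s ((hpos 0).trans hX) (hpos 0) (mul_neg_of_pos_of_neg hXval (by linarith))
  · rw [← Fin.succ_castSucc, Matrix.cons_val_succ, Matrix.cons_val_succ]
    exact eval_mul_eval_neg Ξ U hΞ hU s (hpos _) (hpos _)
      (WLawArrow.prod_neg_of_alt (fun x => M₄[Ξ, U](x) + s * x ^ 16) σ hsigns i)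

end PivotArrowFour

/-- **`Z₊ ≥ 6m − 4` AT `(m, K) = (m, 4)`, INDEX ONE, EVERY `m`**: `¬ PivotRootLawAt m 4 1 (6m − 5)` for all `m ≥ 1`.
[folklore] -/
theorem not_pivotRootLawAt_four_one {m : ℕ} (hm : 1 ≤ m) : ¬ Pivot.PivotRootLawAt m 4 1 (6 * m - 5) := by
  obtain ⟨k, rfl⟩ : ∃ k, m = k + 1 := ⟨m - 1, by omega⟩
  intro h
  obtain ⟨J, P, W, hJ, hP, hW, hA⟩ := PivotArrowFour.exists_pivotConfig_indexOne k
  have h5 := h 3 ![0, 2, 5, 19] J P hJ hP ⟨W, hW⟩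
  omega

/-- In law form: `PivotRootLawAt m 4 1 B → 6m − 4 ≤ B` (`m ≥ 1`). [bookkeeping] -/
theorem le_of_pivotRootLawAt_four_one {m B : ℕ} (hm : 1 ≤ m) (h : Pivot.PivotRootLawAt m 4 1 B) :
    6 * m - 4 ≤ B := by
  by_contra hB
  exact not_pivotRootLawAt_four_one hm (Pivot.pivotRootLawAt_mono h (by omega))

/-- **The bilinear rank-one pivot law is SHARP along `K = 4` if it holds**: under `RankOnePivotLawBilinear` (typed, NOT
asserted), `PivotRootLawAt m 4 1 B ↔ 6m − 4 ≤ B` for every `m ≥ 1`. [bookkeeping] -/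
theorem pivotRootLawAt_four_one_iff_of_bilinear (hbil : Pivot.RankOnePivotLawBilinear) {m B : ℕ} (hm : 1 ≤ m) :
    Pivot.PivotRootLawAt m 4 1 B ↔ 6 * m - 4 ≤ B := by
  refine ⟨le_of_pivotRootLawAt_four_one hm, fun hB => ?_⟩
  have h := hbil m 4
  refine Pivot.pivotRootLawAt_mono h ?_
  omega

end Summit.ValiantsHypothesis.ValiantsHypothesis.Theorems.LacunarySymmetroidMatrixDescartes
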